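import Summits.BirchSwinnertonDyer.BirchSwinnertonDyer.Theorems.KatoDescentKMCImpReading
import Summits.BirchSwinnertonDyer.BirchSwinnertonDyer.Theorems.InertBadSignedBranchesCccOneLawOnTypeIstarZeroOfKMCPerrinRiou
import HarnessLib

set_option linter.dupNamespace false
set_option autoImplicit false

/-!
# Route `InertBadSignedBranches` (rung K8), crux `CccOneLawOnTypeIstarZero` (stmt-BirchSwinnertonDyer-19223):
# the Kato–Perrin-Riou composition over the `→`-ONLY interface reading, and — at the CLOSED triple
# `(IsKatoZetaDescentDatumOf, Kato2004.PRRatio, KatoMainConjectureFine)` — the crux BY NAME from FIVE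
# stub-shaped hypotheses, the interface lemma DISCHARGED in the kernel
# (cell `bsd-cm`, seat `bsd-cm-k7r-c4` g13 for the line owner `bsd-cm-k8i-c2`, planner pointer D384 «K-CUT-1»;
# helper `--supports` 19223; theorems only; nothing asserted, no item closed)

WHY THIS FILE. The skeleton of record `Cruxes/CccOneLawOnTypeIstarZero/Lines/kato_perrin_riou_istar.lean`
(bf5f558eeaac7e6d) concludes the crux from SIX closed stubs through seat k8i-c2 g4's record
`CccOneKMCPerrinRiou.cccOneLawOnTypeIstarZero_of_kmc_of_perrinRiou` (p447913), whose hypothesis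
`hread : ReadsTrivialKMC IsOf KMC` is the IFF reading — stub 5 `stub_readsTrivialKMCFine`. Only its `→` half is
used on the composition path (`TorsionFree.rankOne_missingPPartAt_of_kmc_of_perrinRiou`), and that half is
KERNEL at the closed binders (glue p612876). §1 re-proves p447913's §1–§2 over the weaker binder
`(hread : ∀ W p D, IsOf W p D → KMC W p → D.Conj1210)` (generic part: `…Theorems.KatoDescentKMCImpReading`);
§2 instantiates at the closed triple and discharges the binder by
`KatoDescentKMCImpReading.conj1210_of_isOf_of_kmcFine`, so that

  `cccOneLawOnTypeIstarZero_of_kmcFine_of_perrinRiouRatio :`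
  `  RankOneCountReading♭ → RealizableOfKMC♭ → (∀ type pairs, KMC_fine) → (∀ type pairs, PR^×) →`
  `  PrintReadingsInert → PublishedFactsInert → crux`

is the composition of a FIVE-stub skeleton (stubs 1, 2, 3, 4, 6 of the registered line, verbatim signatures;
stub 5 deleted) — for the planner / the line owner k8i-c2 to re-point and re-register (this file registers
nothing).

HONEST LABEL: every statement is CONDITIONAL on displayed hypotheses; the two research inputs (Perrin-Riou's
conjecture up to a `p`-adic unit at the additive inert prime `p ≥ 5` of type `I₀*`, Kato's Main Conjecture
12.10 in fine-Selmer form), the two print readings and the route's support items 19226 / 19227 remain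
hypotheses; nothing about them or about BSD is asserted; no definition, no named fact, no instance, no
`sorry`; the crux is concluded BY NAME, never restated; 19223 stays OPEN; BSD is not proved for any curve.
[cite: BurnsKuriharaSano2019, Thm. 7.6 (p. 29), Conj. 2.8 (ii) (p. 10)] [cite: Kato2004Asterisque, Conj. 12.10 (p. 224), §14.14 (p. 243)]
[cite: Kobayashi2003, §4 (p. 8), Thm. 7.4 (p. 13)] [cite: PerrinRiou1993AIF, §3.3] [cite: Miller2011LMS, §1 and Def. 1.1]
-/

noncomputable section

open scoped Classical NumberField

open WeierstrassCurve Literature.NumberTheory.EllipticCurves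
open Literature.NumberTheory.EllipticCurves.Rank1Residual
open Literature.NumberTheory.EllipticCurves.Rank1Residual.Typed
open Summit.BirchSwinnertonDyer.Rank1Residual
open Summit.BirchSwinnertonDyer.Rank1Residual.Additive
open Summit.BirchSwinnertonDyer.Rank1Residual.X12.O10
open Summit.BirchSwinnertonDyer.BirchSwinnertonDyer.Theses.InertBadSignedBranches
open Summit.BirchSwinnertonDyer.BirchSwinnertonDyer.Theorems.CccOneLowerHalf
open Summit.BirchSwinnertonDyer.BirchSwinnertonDyer.Theorems.KatoDescentKMCImpReading

namespace Summit.BirchSwinnertonDyer.BirchSwinnertonDyer.Theorems.CccOneKMCImpReading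

/-! ## §1 Over the interface binders, with the `→`-only reading -/

section Descent

variable {IsOf : ∀ (W : WeierstrassCurve ℚ) [W.IsElliptic] [W.IsGloballyMinimal] (p : ℕ) [Fact p.Prime],
  KatoDescentDatum p → Prop}
variable {PRRatio : ∀ (W : WeierstrassCurve ℚ) [W.IsElliptic] [W.IsGloballyMinimal] (p : ℕ)
  [Fact p.Prime], ℚ_[p] → Prop}
variable {KMC : ∀ (W : WeierstrassCurve ℚ) [W.IsElliptic] [W.IsGloballyMinimal] (p : ℕ), Prop}

/-- **`BSD(W, p)` at every rank-one pair of the signed type `(p, I₀*)`, `p ≥ 5`, from KMC(T_pW) ∧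
PR^×(W, p) there, over the `→`-only reading** — the generic descent
`KatoDescentKMCImpReading.rankOne_missingPPartAt_of_kmcImp_of_perrinRiou`, side conditions by p447913's §0
(`addv_and_j_nonneg_and_not_dvd_torsionOrder_of_hasSignedLocalType`), `p ≠ 2` from `5 ≤ p`. CONDITIONAL on the
readings, GZK, modularity, KMC and PR^× on the type; nothing booked.
[cite: BurnsKuriharaSano2019, Thm. 7.6 (p. 29)] [cite: Kato2004Asterisque, Conj. 12.10 (p. 224)] -/
theorem bsdpOnType_of_kmcImp_of_perrinRiou
    (hC : TorsionFree.RankOneCountReading IsOf PRRatio) (hreal : TorsionFree.RealizableOfKMC IsOf KMC)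
    (hread : ∀ (W : WeierstrassCurve ℚ) [W.IsElliptic] [W.IsGloballyMinimal] (p : ℕ) [Fact p.Prime]
      (D : KatoDescentDatum p), IsOf W p D → KMC W p → D.Conj1210)
    (hGZK : rank_eq_analyticRank_of_analyticRank_le_one) (hmod : hasEntireLFunction_rat)
    (hKMC : ∀ (p : ℕ) [Fact p.Prime], 5 ≤ p → ∀ (W : WeierstrassCurve ℚ) [W.IsElliptic]
      [W.IsGloballyMinimal], HasSignedLocalType W p (.Istar 0) → W.analyticRank = 1 → KMC W p)
    (hPR : ∀ (p : ℕ) [Fact p.Prime], 5 ≤ p → ∀ (W : WeierstrassCurve ℚ) [W.IsElliptic]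
      [W.IsGloballyMinimal], HasSignedLocalType W p (.Istar 0) → W.analyticRank = 1 →
      PerrinRiouUpToUnitAt PRRatio W p)
    (p : ℕ) [Fact p.Prime] (hp5 : 5 ≤ p) (W : WeierstrassCurve ℚ) [W.IsElliptic] [W.IsGloballyMinimal]
    (hT : HasSignedLocalType W p (.Istar 0)) (hr : W.analyticRank = 1) : BSDp W p := by
  obtain ⟨haddv, hj, htors⟩ :=
    CccOneKMCPerrinRiou.addv_and_j_nonneg_and_not_dvd_torsionOrder_of_hasSignedLocalType W p (by omega) hT
  exact bsdp_of_missingPPartAt W p hGZK (by rw [hr])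
    (rankOne_missingPPartAt_of_kmcImp_of_perrinRiou W p hC hreal hread hGZK hmod hr (by omega) haddv hj
      htors (hPR p hp5 W hT hr) (hKMC p hp5 W hT hr))

/-- **Crux 19223 `CccOneLawOnTypeIstarZero` ⟸ KMC(T_pW) ∧ PR^×(W, p) at every rank-one pair of the type
`(p, I₀*)`, `p ≥ 5`, over the `→`-ONLY reading** — and readings 1″♭ / 3♭, the route's support items
`PrintReadingsInert` (19226) and `PublishedFactsInert` (19227) (bsd-cm-inert's
`cccOneLawOnTypeIstarZero_of_bsdpOnType`). p447913's `cccOneLawOnTypeIstarZero_of_kmc_of_perrinRiou` with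
`ReadsTrivialKMC IsOf KMC` weakened to the binder; the old record is the special case
`hread := kmcImp_of_readsTrivialKMC h`. The crux is concluded BY NAME. CONDITIONAL; nothing booked; 19223 stays
OPEN. [cite: BurnsKuriharaSano2019, Thm. 7.6 (p. 29)] [cite: Kato2004Asterisque, Conj. 12.10 (p. 224), §15]
[cite: Kobayashi2003, §4 (p. 8), Thm. 7.4 (p. 13)] [cite: PerrinRiou1993AIF, §3.3] -/
theorem cccOneLawOnTypeIstarZero_of_kmcImp_of_perrinRiou
    (hC : TorsionFree.RankOneCountReading IsOf PRRatio) (hreal : TorsionFree.RealizableOfKMC IsOf KMC)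
    (hread : ∀ (W : WeierstrassCurve ℚ) [W.IsElliptic] [W.IsGloballyMinimal] (p : ℕ) [Fact p.Prime]
      (D : KatoDescentDatum p), IsOf W p D → KMC W p → D.Conj1210)
    (hKMC : ∀ (p : ℕ) [Fact p.Prime], 5 ≤ p → ∀ (W : WeierstrassCurve ℚ) [W.IsElliptic]
      [W.IsGloballyMinimal], HasSignedLocalType W p (.Istar 0) → W.analyticRank = 1 → KMC W p)
    (hPR : ∀ (p : ℕ) [Fact p.Prime], 5 ≤ p → ∀ (W : WeierstrassCurve ℚ) [W.IsElliptic]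
      [W.IsGloballyMinimal], HasSignedLocalType W p (.Istar 0) → W.analyticRank = 1 →
      PerrinRiouUpToUnitAt PRRatio W p)
    (h₅ : PrintReadingsInert) (h₆ : PublishedFactsInert) : CccOneLawOnTypeIstarZero := by
  obtain ⟨hmod, -, hGZK, hPT, -, -⟩ := h₆
  exact cccOneLawOnTypeIstarZero_of_bsdpOnType h₅ hmod hGZK hPT
    (fun p _ hp5 W _ _ hT hr ↦ bsdpOnType_of_kmcImp_of_perrinRiou hC hreal hread hGZK hmod hKMC hPR p
      hp5 W hT hr)

end Descent

/-! ## §2 At the CLOSED triple: the crux BY NAME from FIVE stub-shaped hypotheses -/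

section Closed

/-- **Crux 19223 `CccOneLawOnTypeIstarZero` BY NAME from the FIVE remaining stubs of the Kato–Perrin-Riou
line** — reading 1″♭ `TorsionFree.RankOneCountReading IsKatoZetaDescentDatumOf Kato2004.PRRatio` (stub 3),
reading 3♭ `TorsionFree.RealizableOfKMC IsKatoZetaDescentDatumOf KatoMainConjectureFine` (stub 4), `∀` rank-one
pairs of type `(p, I₀*)`, `p ≥ 5`: `KatoMainConjectureFine W p` (stub 2) and `PerrinRiouUpToUnitAt Kato2004.PRRatio W p`
(stub 1), and `PrintReadingsInert ∧ PublishedFactsInert` (stub 6, as two hypotheses) — the interface lemma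
(former stub 5) being DISCHARGED by `KatoDescentKMCImpReading.conj1210_of_isOf_of_kmcFine` (glue p612876).
Intended as the composition term of the re-pointed skeleton (planner's / line owner's registration; this file
registers nothing). CONDITIONAL on the five displayed hypotheses; nothing booked; 19223 stays OPEN; BSD is not
proved for any curve. [cite: BurnsKuriharaSano2019, Thm. 7.6 (p. 29), Conj. 2.8 (ii) (p. 10)]
[cite: Kato2004Asterisque, Conj. 12.10 (p. 224), §14.14 (p. 243)] [cite: Kobayashi2003, §4 (p. 8), Thm. 7.4 (p. 13)] -/
theorem cccOneLawOnTypeIstarZero_of_kmcFine_of_perrinRiouRatio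
    (hC : TorsionFree.RankOneCountReading IsKatoZetaDescentDatumOf Kato2004.PRRatio)
    (hreal : TorsionFree.RealizableOfKMC IsKatoZetaDescentDatumOf KatoMainConjectureFine)
    (hKMC : ∀ (p : ℕ) [Fact p.Prime], 5 ≤ p → ∀ (W : WeierstrassCurve ℚ) [W.IsElliptic]
      [W.IsGloballyMinimal], HasSignedLocalType W p (.Istar 0) → W.analyticRank = 1 →
      KatoMainConjectureFine W p)
    (hPR : ∀ (p : ℕ) [Fact p.Prime], 5 ≤ p → ∀ (W : WeierstrassCurve ℚ) [W.IsElliptic]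
      [W.IsGloballyMinimal], HasSignedLocalType W p (.Istar 0) → W.analyticRank = 1 →
      PerrinRiouUpToUnitAt Kato2004.PRRatio W p)
    (h₅ : PrintReadingsInert) (h₆ : PublishedFactsInert) : CccOneLawOnTypeIstarZero :=
  cccOneLawOnTypeIstarZero_of_kmcImp_of_perrinRiou hC hreal conj1210_of_isOf_of_kmcFine hKMC hPR h₅ h₆

/-- **`BSD(W, p)` at a rank-one pair of the type `(p, I₀*)`, `p ≥ 5`, at the closed triple** — per-pair form
of §2 (no interface-lemma hypothesis; GZK and modularity displayed). CONDITIONAL.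
[cite: BurnsKuriharaSano2019, Thm. 7.6 (p. 29)] [cite: Kato2004Asterisque, Conj. 12.10 (p. 224)] -/
theorem bsdpOnType_of_kmcFine_of_perrinRiouRatio
    (hC : TorsionFree.RankOneCountReading IsKatoZetaDescentDatumOf Kato2004.PRRatio)
    (hreal : TorsionFree.RealizableOfKMC IsKatoZetaDescentDatumOf KatoMainConjectureFine)
    (hGZK : rank_eq_analyticRank_of_analyticRank_le_one) (hmod : hasEntireLFunction_rat)
    (p : ℕ) [Fact p.Prime] (hp5 : 5 ≤ p) (W : WeierstrassCurve ℚ) [W.IsElliptic] [W.IsGloballyMinimal]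
    (hT : HasSignedLocalType W p (.Istar 0)) (hr : W.analyticRank = 1) (hKMC : KatoMainConjectureFine W p)
    (hPR : PerrinRiouUpToUnitAt Kato2004.PRRatio W p) : BSDp W p := by
  obtain ⟨haddv, hj, htors⟩ :=
    CccOneKMCPerrinRiou.addv_and_j_nonneg_and_not_dvd_torsionOrder_of_hasSignedLocalType W p (by omega) hT
  exact rankOne_bsdp_of_kmcFine_of_perrinRiouRatio hC hreal hGZK hmod W p hr (by omega) haddv hj htors hPR
    hKMC

end Closed

end Summit.BirchSwinnertonDyer.BirchSwinnertonDyer.Theorems.CccOneKMCImpReading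

end
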